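import Summits.BirchSwinnertonDyer.BirchSwinnertonDyer.Theorems.PrintCf2SplitBadEisensteinTwoOddSocketObstruction
import Summits.BirchSwinnertonDyer.BirchSwinnertonDyer.Theorems.SchneiderFreeAdditiveX3AnticycControlAdditiveStubBaseCountTorsOfFacts
import Literature.NumberTheory.EllipticCurves.AnticyclotomicPrimeDecompositionAnyPrimeProofs
import HarnessLib

/-!
# Line `eisenstein_two_bdp_line` (crux `PrintCf2.SplitBadTwoRankOneOfFacts`, stmt-BirchSwinnertonDyer-20368):
# the tree's torsion-aware anticyclotomic (∅,0) control machine, RUN AT `p = 2`, gives defect `0` —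
# so the registered `stub_control_two` (defect `+1`) is REFUTED modulo two torsion-finiteness atoms at `2`
# and Poitou–Tate, and the line's typed `2`-adic normalisations are jointly inconsistent with `BSD₂`
# (and with the crux itself) modulo the same atoms

Seat bsd-line-cf2-p1 g6 (LEAD of crux 20368), cell `pub/bsd-print-cf2`. BSD is not proved by any of this; nothing
registered is closed; every theorem here is CONDITIONAL on displayed hypotheses (no `Prop` fact is minted).

WHAT IS COMPUTED. Cell bsd-schneider's route `SchneiderFreeAdditiveX3` proved the Jetchev–Skinner–Wan Thm 3.3.1-type
control EQUALITY `SchneiderFree.AdditiveControlOnTreeAt p κ 𝔭 γ ι P` — `ord_p f(0) = ord_p #Ш(E/K)[p^∞] +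
2·(ord_p log_ω P − ord_p [E(K):ℤP]) + ord_p ∏_{w ∣ N⁺} c_w`, NO torsion term — for EVERY global / local `p`-torsion
(`additiveControlOnTreeAt_of_torsAtoms`: the exponents `g = ord_p #E(K)[p^∞]` and `t = ord_p #E(ℚ_p)[p^∞]` CANCEL against
the torsion-aware base count `additiveBaseSelmerCountTors_of_rankOne_anyTorsion`, itself a theorem at EVERY prime from
Poitou–Tate and the local Euler–Poincaré characteristic), with the atoms (P9-𝓒) `ptSurj_of_finite`, (L10)
`coinvariantsTrivialAt_of_finite_anyTorsion`, (P11) `localKernelOrderAt_of_not_le` — all stated and proved for an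
ARBITRARY prime `p`. The crux-level assembly of that cell (`anticycControlAdditiveK_of_poitouTate`) carries `p ≠ 2`
only through three FINITENESS inputs (`finite_fixedPoints_kerSubgroup_of_not_dvd_torsionOrder` needs `p ∤ #𝓞_K^×`;
item `LocalTowerTorsionFiniteX3`; Brink 2007, typed for odd `p`). §1 below runs the same assembly at the literal
prime `2` with the two torsion-finiteness inputs as HYPOTHESES and Brink's two statements at `l = 2` as THEOREMS
(`ZpExtension.decomp_not_le_kerSubgroup_of_isAnticyclotomic_anyPrime`, `…_above_…_anyPrime`, file
`Literature/NumberTheory/EllipticCurves/AnticyclotomicPrimeDecompositionAnyPrimeProofs.lean`, this seat — the tree's parity-free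
proofs of the odd-`p` named facts re-run without the `p ≠ 2` binder):

* (Fin_glob) `E(K_∞)[2^∞]` finite (`Finite (FixedPoints.addSubgroup κ.kerSubgroup (geomPrimaryTorsion (E_K) 2))`);
* (Fin_loc) `SchneiderFreeControlAtoms.LocalTowerTorsionFiniteAt (E_K) 2 κ 𝔭` (`E(K_{∞,𝔭})[2^∞]` finite).

RESULTS.
* §1 `additiveControlOnTreeAt_two_of_finAtoms` — (Fin_glob) + (Fin_loc) + Poitou–Tate (Selmer structures; `Ш`) + `rank E(K) = 1`, `Ш(E/K)` finite, `P` non-torsion, `W` additive at `2`, `K` imaginary quadratic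
  with `2` split ⟹ `AdditiveControlOnTreeAt 2 κ 𝔭 γ (embAt K 2 𝔭) P` (defect `0`).
* §2 `not_controlPlusOne_of_additiveControlOnTreeAt` — defect `0` and defect `+1` at the same frame are incompatible
  (`XAc.HasCharValuationAt.unique`); hence `controlTwo_plusOne_false_of_finAtoms`: on any class member carrying the
  two atoms at one anticyclotomic frame, the BODY of the registered `stub_control_two` (skeleton 40d712dab9aaf49c /
  859a52caf8e1b3b4, statement VERBATIM, instantiated there) is FALSE.
* §3 `eisensteinTwoBdp_typedNormalisations_inconsistent_of_finAtoms` — the two atoms + Poitou–Tate + the line's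
  typed inputs at ONE datum (an integral ♭-BDP frame `R1.IsBDPLFunctionInt 2 …` at `𝔭`, the ♭-IMC EQUALITY
  `(Ch X_(∅,0) at 𝔭′)·𝓞_{ℂ₂}⟦T⟧ = (Q)`, Liu–Zhang–Zhang as typed at `2`, Milne 1972) + `BSD₂(W)` + `BSD₂(W^{(d_K)})`
  ⟹ `False` (composition of §1 with -w2 g3's `not_additiveControlOnTreeAt_two_of_flatIMCEq_of_bsdp`).
* (companion file `PrintCf2SplitBadEisensteinTwoControlAtTwoOfAtomsCrux.lean`, which needs the route file's crux decl)
  `crux_typedNormalisations_inconsistent_of_finAtoms` — the same with `BSD₂(W)` supplied by THE CRUX ITSELF and `BSD₂(W^{(d_K)})`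
  by Burungale–Flach: if the crux is true, the line's typed frame + ♭-IMC equality at `2` cannot hold at any datum of the class
  carrying the two atoms.

READING (lead verdict g6). The `+1` of `stub_control_two` was PINNED (g5, -w2 g3) by the typed `2`-adic display
`Q(𝟙) = u·(log_ω P/c)²`, `‖u‖₂ = 1/2` (odd `ord₂`), a kernel consequence of the Literature reading of Liu–Zhang–Zhang's
constants at `2` (`(2/h_K)²`, `w_K/h_K`, `L(1,η) = 2πh_K/(w_K√|d_K|)`) inside the frame predicate `R1.IsBDPLFunctionInt 2`;
the torsion-aware control machine gives EVEN `ord₂ f(0)`. So, granted `BSD₂` on the class and the four atoms: at least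
one typed `2`-power normalisation among {frame predicate at `2`, LZZ reading at `2`, the ♭-IMC equality as an equality of
ideals} is off by an ODD power of `2` (net), OR one of the two torsion-finiteness atoms fails at `2` on `49a1^{(d)}/K″`. The research content of the line's
control stub is therefore NOT «JSW at an Eisenstein 2 with defect +1» but «which typed constant carries the `2`»; the
lead's reshape proposal (PICKED § g6 addendum) replaces `stub_control_two` by the defect-free socket (§1, nearly closed)
and moves the factor of `2` into the analytic normalisation, pending the pen / critic.

References: Jetchev–Skinner–Wan, Camb. J. Math. 5 (2017) Thm. 3.3.1, Prop. 3.2.1, Lemma 3.3.3 (arXiv:1512.06894 pp. 10–13);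
Greenberg, LNM 1716 (1999) §3–4 (Lemma 3.3, Lemma 4.3, Prop. 4.14); Brink, Proc. AMS 135 (2007) Thm. 2, Cor. 1; Castella,
Math. Ann. (2018) Thm. 2.3; Keller–Yin arXiv:2402.12781 App. B Thm. B.0.6; Liu–Zhang–Zhang, Duke Math. J. 167 (2018)
Thm 1.5.1/1.5.3; Milne, Invent. Math. 17 (1972) §1 Thm 1.
-/

noncomputable section

open scoped Classical

open WeierstrassCurve NumberField IsDedekindDomain Field
  Literature.NumberTheory.EllipticCurves
  Literature.NumberTheory.EllipticCurves.ModularForms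
  Literature.NumberTheory.EllipticCurves.GreenbergSelmer
  Literature.NumberTheory.GaloisRepresentations
  Literature.NumberTheory.GaloisCohomology
  Literature.NumberTheory.EllipticCurves.Rank1Residual
  Literature.NumberTheory.EllipticCurves.Rank1Residual.Typed
  Summit.BirchSwinnertonDyer.Rank1Residual
  Summit.BirchSwinnertonDyer.Rank1Residual.X11b
  Summit.BirchSwinnertonDyer.Rank1Residual.X11b.AcSelmer
  Summit.BirchSwinnertonDyer.BirchSwinnertonDyer.Theorems.SchneiderFree
  Summit.BirchSwinnertonDyer.BirchSwinnertonDyer.Theorems.SchneiderFreeControlAtoms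
  Summit.BirchSwinnertonDyer.BirchSwinnertonDyer.Theorems.SchneiderFreeAdditiveX3
  Summit.BirchSwinnertonDyer.BirchSwinnertonDyer.Theses.UniversalToricDescent
  Summit.BirchSwinnertonDyer.Rank1Residual.X11b.LocBridge

set_option linter.dupNamespace false
set_option autoImplicit false

namespace Summit.BirchSwinnertonDyer.BirchSwinnertonDyer.Theorems.PrintCf2.EisensteinTwo

/-! ## §1 The torsion-aware control machine at `p = 2` -/

/-- **Anticyclotomic (∅,0) control EQUALITY at the additive prime `2`, defect `0`, from two torsion-finiteness
atoms at `2` and Poitou–Tate.** For `W/ℚ` globally minimal, ADDITIVE at `2`, `K` imaginary quadratic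
with `2` split, `rank E(K) = 1`, `Ш(E/K)` finite, `P ∈ E(K)` non-torsion, an anticyclotomic `κ` with topological
generator `γ`, a degree-one `𝔭 ∣ 2`: (Fin_glob) ∧ (Fin_loc at `𝔭`) ⟹
`SchneiderFree.AdditiveControlOnTreeAt 2 κ 𝔭 γ (embAt K 2 𝔭) P`, i.e. `∃ n, XAc.HasCharValuationAt (E_K) 2 κ 𝔭 ∅ γ n ∧
n = ord₂ #Ш(E/K)[2^∞] + 2·(ord₂ log_ω P − ord₂ [E(K):ℤP]) + ord₂ ∏_{w ∣ N⁺} c_w`. Proof = cell bsd-schneider's assembly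
(`stub_baseCountTors_of_facts` + `anticycControlAdditiveK_of_facts_of_baseCountTors`) with its three odd-`p` finiteness
lemmas replaced by the displayed hypotheses: `g = ord₂ #E(K)[2^∞]` (`natCard_ker_resOfLe_top_eq_natCard_fixedPoints`),
`t = ord₂ #E(ℚ₂)[2^∞]` (`natCard_localKer_eq_pow_of_finite` + Brink Cor. 1 at `2`), the base count `additiveBaseSelmerCountTors_of_rankOne_anyTorsion`
(any prime), (P9-𝓒) `ptSurj_of_finite`, (L10) `coinvariantsTrivialAt_of_finite_anyTorsion`, (P11) `localKernelOrderAt_of_not_le`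
(+ Brink Thm. 2 at `2`), glued by `additiveControlOnTreeAt_of_torsAtoms` (the exponents `g`, `t` cancel). CONDITIONAL; closes nothing.
[cite: JetchevSkinnerWan2017, Thm. 3.3.1, Prop. 3.2.1 and Lemma 3.3.3 (arXiv:1512.06894 pp. 10–13)]
[cite: GreenbergLNM1716, §3 Lemma 3.3 and §4 Lemma 4.3] [cite: Castella2018, Thm. 2.3 (arXiv:1704.06608 p. 5)]
[cite: MilneADT2006, Ch. I, Thm. 4.10 and Thm. 2.8] [cite: Brink2007, Thm. 2 and Cor. 1] -/
theorem additiveControlOnTreeAt_two_of_finAtoms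
    {K : Type} [Field K] [NumberField K]
    (hPT : poitouTate_selmerStructure_duality K) (hPT2 : poitouTate_sha_tateDual K)
    (W : WeierstrassCurve ℚ) [W.IsElliptic] [W.IsGloballyMinimal] (hadd : Addv W 2)
    (hK : IsImaginaryQuadratic K) (hsplit : SplitsIn K 2) (h2N : 2 ∣ W.conductorNorm ℤ)
    (hrank : (W.baseChange K).mordellWeilRank = 1) (hSha : (W.baseChange K).ShaFinite)
    (P : (W.baseChange K).toAffine.Point) (hnt : ¬ IsOfFinAddOrder P)
    (κ : ZpExtension K 2) (hκ : κ.IsAnticyclotomic) (γ : absoluteGaloisGroup K) [Fact (κ.IsTopGenerator γ)]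
    (𝔭 : HeightOneSpectrum (𝓞 K)) (h𝔭 : ((2 : ℕ) : 𝓞 K) ∈ 𝔭.asIdeal)
    (he : 𝔭.asIdeal.ramificationIdx (𝓞 ℚ) = 1) (hf : 𝔭.asIdeal.inertiaDeg (𝓞 ℚ) = 1)
    (hFinG : Finite (FixedPoints.addSubgroup κ.kerSubgroup (geomPrimaryTorsion (W.baseChange K) 2)))
    (hFinL : LocalTowerTorsionFiniteAt (W.baseChange K) 2 κ 𝔭) :
    SchneiderFree.AdditiveControlOnTreeAt 2 κ 𝔭 γ (embAt K 2 𝔭 h𝔭 he hf) P := by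
  haveI : IsTotallyComplex K := hK.2
  -- Brink 2007 at `l = 2`: the prime `𝔭 ∣ 2` and the split primes `v ∤ 2` are finitely decomposed in `K_∞`
  have hBr𝔭 : ¬ decomp 𝔭 ≤ κ.kerSubgroup :=
    ZpExtension.decomp_not_le_kerSubgroup_above_of_isAnticyclotomic_anyPrime K 2 hK κ hκ 𝔭 h𝔭
  have hBrN : ∀ v ∈ nPlusPlaces W K 2, ¬ decomp v ≤ κ.kerSubgroup := fun v hv ↦ by
    obtain ⟨hpv, -, hev, hfv⟩ := (mem_nPlusPlaces_iff v).mp hv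
    exact ZpExtension.decomp_not_le_kerSubgroup_of_isAnticyclotomic_anyPrime K 2 hK κ hκ v hpv hev hfv
  haveI hEK : (W.baseChange K).IsElliptic := by rw [baseChange]; infer_instance
  -- `g = ord₂ #E(K)[2^∞]`
  set g₀ := padicValNat 2 (Nat.card (AddCommGroup.primaryComponent (W.baseChange K).toAffine.Point 2))
    with hg₀def
  have hcardg := natCard_primaryComponent_point_eq_pow (W.baseChange K) 2
  haveI := hFinG
  have hres : Nat.card ((W.baseChange K).resOfLe 2 (le_top : κ.kerSubgroup ≤ ⊤)).ker = 2 ^ g₀ := by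
    rw [natCard_ker_resOfLe_top_eq_natCard_fixedPoints (W.baseChange K) 2 κ,
      natCard_fixedPoints_geomPrimaryTorsion_eq_natCard_primaryComponent (W.baseChange K) 2, hcardg]
  -- `t = ord₂ #E(ℚ₂)[2^∞]`
  obtain ⟨tp, htp⟩ := exists_natCard_primaryComponent_padic_eq_pow W 2
  have h𝔭ker := natCard_localKer_eq_pow_of_finite W 2 κ 𝔭 h𝔭 he hf hFinL hBr𝔭 htp
  -- the torsion-aware base count at the additive prime `2` (any prime)
  obtain ⟨hfin𝔭, a, hcard, ha⟩ := additiveBaseSelmerCountTors_of_rankOne_anyTorsion W 2 K hPT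
    (fun v ↦ localEulerPoincareCharacteristic_adicCompletionEP K v) hadd hK hsplit hrank hSha P hnt 𝔭 h𝔭 he hf
  have hcard' : Nat.card (selmerAcBase (W.baseChange K) 2 𝔭 ∅) * 2 ^ tp = 2 ^ a := by
    rw [← htp]; exact hcard
  have hle : tp ≤ a :=
    (Nat.pow_dvd_pow_iff_le_right (by norm_num : 1 < 2)).mp ⟨_, by rw [mul_comm]; exact hcard'.symm⟩
  have hcardSel : Nat.card (selmerAcBase (W.baseChange K) 2 𝔭 ∅) = 2 ^ (a - tp) := by
    have hsplitpow : (2 : ℕ) ^ a = 2 ^ (a - tp) * 2 ^ tp := by rw [← pow_add, Nat.sub_add_cancel hle]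
    rw [hsplitpow] at hcard'
    exact Nat.eq_of_mul_eq_mul_right (pow_pos (by norm_num : 0 < 2) tp) hcard'
  have h6 : (∃ _ : Finite (selmerAcBase (W.baseChange K) 2 𝔭 ∅),
        Nat.card (selmerAcBase (W.baseChange K) 2 𝔭 ∅) = 2 ^ (a - tp)) ∧
      ((a - tp : ℕ) : ℤ) = (padicValNat 2
          (Nat.card (AddCommGroup.primaryComponent (W.baseChange K).sha 2)) : ℤ) +
        2 * (X11b.padicLogOrd W 2 (embAt K 2 𝔭 h𝔭 he hf) P -
          (padicValNat 2 (AddSubgroup.zmultiples P).index : ℤ)) +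
          padicValNat 2 (X11b.tamagawaProductAbove W K 2) + g₀ - tp := by
    refine ⟨⟨hfin𝔭, hcardSel⟩, ?_⟩
    rw [Nat.cast_sub hle, ha]
  -- finiteness of Castella's Selmer groups at both primes above `2` (rank one + `Ш` finite)
  have hfinall : ∀ v : HeightOneSpectrum (𝓞 K), ((2 : ℕ) : 𝓞 K) ∈ v.asIdeal →
      Finite (selmerAcBase (W.baseChange K) 2 v ∅) := fun v hv ↦ by
    obtain ⟨hev, hfv⟩ := degreeOne_of_splitsIn hK.1 hsplit hv
    exact finite_selmerAcBase_of_rankOne_anyTorsion W 2 K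
      (poitouTate_sum_localTatePairing_eq_zero_of_selmerStructure_duality hPT) hK hsplit hrank hSha
      v hv hev hfv
  -- the conjugate prime `𝔮 = 𝔭̄`
  obtain ⟨σ, 𝔮, -, hne, h𝔮, -⟩ := LocalIndexTransport.exists_conj_prime_of_splitsIn K 2 hK.1 hsplit h𝔭
  exact additiveControlOnTreeAt_of_torsAtoms (W := W) hK hsplit h2N hκ γ 𝔭 h𝔭 (embAt K 2 𝔭 h𝔭 he hf)
    P g₀ tp (a - tp) hres h𝔭ker h6
    (ptSurj_of_finite W 2 hK hsplit hPT h𝔭 h𝔮 hne (hfinall 𝔮 h𝔮) κ)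
    (coinvariantsTrivialAt_of_finite_anyTorsion W 2 hK hsplit hPT hPT2 κ
      (Fact.out : κ.IsTopGenerator γ) h𝔭 hfinall)
    (fun v hv ↦ localKernelOrderAt_of_not_le (W.baseChange K) κ ((mem_nPlusPlaces_iff v).mp hv).1 (hBrN v hv))

/-! ## §2 Defect `0` versus defect `+1` -/

/-- **Two control equalities at the same frame with different defects are incompatible** (`ord₂ f(0)` is well
defined: `XAc.HasCharValuationAt.unique`): `AdditiveControlOnTreeAt 2 κ 𝔭 γ ι P` (defect `0`) excludes the
defect-`+1` statement at `(κ, γ, 𝔭, ι, P)`. Pure bookkeeping; CONDITIONAL; closes nothing.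
[cite: Castella2018, Thm. 2.3 (arXiv:1704.06608 p. 5)] -/
theorem not_controlPlusOne_of_additiveControlOnTreeAt
    {K : Type} [Field K] [NumberField K] {W : WeierstrassCurve ℚ} [W.IsElliptic] [W.IsGloballyMinimal]
    {κ : ZpExtension K 2} {𝔭 : HeightOneSpectrum (𝓞 K)} {γ : absoluteGaloisGroup K} [Fact (κ.IsTopGenerator γ)]
    {ι : K →+* ℚ_[2]} {P : (W.baseChange K).toAffine.Point}
    (hctl : SchneiderFree.AdditiveControlOnTreeAt 2 κ 𝔭 γ ι P) :
    ¬ ∃ n : ℕ, XAc.HasCharValuationAt (W.baseChange K) 2 κ 𝔭 ∅ γ n ∧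
        (n : ℤ) = (padicValNat 2 (Nat.card (AddCommGroup.primaryComponent (W.baseChange K).sha 2)) : ℤ) +
          2 * (X11b.padicLogOrd W 2 ι P - (padicValNat 2 (AddSubgroup.zmultiples P).index : ℤ)) +
          padicValNat 2 (X11b.tamagawaProductSplit W K) + 1 := by
  rintro ⟨n, hn, hn1⟩
  obtain ⟨m, hm, hm0⟩ := hctl
  have hmn : m = n := hm.unique hn
  subst hmn
  omega

/-- **The BODY of the registered `stub_control_two` (skeleton 40d712dab9aaf49c, statement VERBATIM) is FALSE on any
class member that carries the two torsion-finiteness atoms at one anticyclotomic frame** (with Poitou–Tate for `K`, the Kolyvagin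
consequences `rank E(K) = 1`, `Ш(E/K)` finite for a non-torsion point, and `2 ∣ N_W` — automatic on the class: CM is
never multiplicative). The stub's `Module.IsTorsion` premise is discharged by the torsion clause inside
`XAc.HasCharValuationAt`. So `stub_control_two` is refuted MODULO (Fin_glob) ∧ (Fin_loc) at one datum (+ Poitou–Tate);
nothing registered is negated unconditionally. CONDITIONAL; closes nothing.
[cite: JetchevSkinnerWan2017, Thm. 3.3.1 (arXiv:1512.06894 p. 11)] -/
theorem controlTwo_plusOne_false_of_finAtoms
    (hC : ∀ (W : WeierstrassCurve ℚ) [W.IsElliptic] [W.IsGloballyMinimal], W.HasCM → W.analyticRank = 1 →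
        CMSplit W 2 → ¬ Good W 2 →
      ∀ (N : ℕ) [NeZero N] (K : Type) [Field K] [NumberField K] (Dt : ModularParametrizationData W N) (H : HeegnerDatum N
      (NumberField.discr K)) (ιK : K →+* ℂ) (P : (W.baseChange K).toAffine.Point), W.conductorNorm ℤ = N → IsImaginaryQuadratic
      K → SatisfiesHeegnerHypothesis N K → WeierstrassCurve.Affine.Point.map ιK.toRatAlgHom P = heegnerPointComplex Dt H → ¬
      IsOfFinAddOrder P → ∀ (κ : ZpExtension K 2), κ.IsAnticyclotomic → ∀ (γ : Field.absoluteGaloisGroup K) [Fact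
      (κ.IsTopGenerator γ)] (𝔭' : HeightOneSpectrum (𝓞 K)) (h𝔭' : ((2 : ℕ) : 𝓞 K) ∈ 𝔭'.asIdeal) (he' :
      𝔭'.asIdeal.ramificationIdx (𝓞 ℚ) = 1) (hf' : 𝔭'.asIdeal.inertiaDeg (𝓞 ℚ) = 1), Module.IsTorsion (IwasawaAlgebra 2) (XAc
      (W.baseChange K) 2 κ 𝔭' ∅ γ) → ∃ n : ℕ, XAc.HasCharValuationAt (W.baseChange K) 2 κ 𝔭' ∅ γ n ∧ (n : ℤ) = (padicValNat 2
      (Nat.card (AddCommGroup.primaryComponent (W.baseChange K).sha 2)) : ℤ) + 2 * (X11b.padicLogOrd W 2 (embAt K 2 𝔭' h𝔭' he'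
      hf') P - (padicValNat 2 (AddSubgroup.zmultiples P).index : ℤ)) + padicValNat 2 (X11b.tamagawaProductSplit W K) + 1)
    {K : Type} [Field K] [NumberField K]
    (hPT : poitouTate_selmerStructure_duality K) (hPT2 : poitouTate_sha_tateDual K)
    (W : WeierstrassCurve ℚ) [W.IsElliptic] [W.IsGloballyMinimal] (hCM : W.HasCM) (hr : W.analyticRank = 1)
    (hsplit2 : CMSplit W 2) (hng : ¬ Good W 2)
    {N : ℕ} [NeZero N] (Dt : ModularParametrizationData W N) (H : HeegnerDatum N (NumberField.discr K)) (ιK : K →+* ℂ)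
    (P : (W.baseChange K).toAffine.Point) (hN : W.conductorNorm ℤ = N) (hK : IsImaginaryQuadratic K)
    (hHN : SatisfiesHeegnerHypothesis N K) (hP : WeierstrassCurve.Affine.Point.map ιK.toRatAlgHom P = heegnerPointComplex Dt H)
    (hnt : ¬ IsOfFinAddOrder P)
    (hrank : (W.baseChange K).mordellWeilRank = 1) (hSha : (W.baseChange K).ShaFinite)
    (κ : ZpExtension K 2) (hκ : κ.IsAnticyclotomic) (γ : absoluteGaloisGroup K) [Fact (κ.IsTopGenerator γ)]
    (𝔭 : HeightOneSpectrum (𝓞 K)) (h𝔭 : ((2 : ℕ) : 𝓞 K) ∈ 𝔭.asIdeal)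
    (he : 𝔭.asIdeal.ramificationIdx (𝓞 ℚ) = 1) (hf : 𝔭.asIdeal.inertiaDeg (𝓞 ℚ) = 1)
    (hFinG : Finite (FixedPoints.addSubgroup κ.kerSubgroup (geomPrimaryTorsion (W.baseChange K) 2)))
    (hFinL : LocalTowerTorsionFiniteAt (W.baseChange K) 2 κ 𝔭) : False := by
  -- `W` is additive at `2` (CM is never multiplicative), so `4 ∣ N_W` and `2` splits in `K`
  have hadd : Addv W 2 := ⟨hng, Literature.NumberTheory.EllipticCurves.Rank1Residual.not_mult_of_hasCM (W := W) hCM 2⟩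
  have h4N : 2 ^ 2 ∣ W.conductorNorm ℤ := by
    by_contra h
    rcases hasGoodReductionAtPrime_or_hasMultiplicativeReductionAtPrime_of_not_sq_dvd_conductorNorm (V := W) h with hg | hm
    · exact hng hg
    · exact hadd.2 hm
  have h2N : (2 : ℕ) ∣ W.conductorNorm ℤ := dvd_trans (dvd_pow_self 2 two_ne_zero) h4N
  have hsplit : SplitsIn K 2 := splitsIn_of_satisfiesHeegnerHypothesis hN hHN h2N
  have hctl := additiveControlOnTreeAt_two_of_finAtoms hPT hPT2 W hadd hK hsplit h2N hrank hSha P hnt κ hκ γ 𝔭 h𝔭 he hf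
    hFinG hFinL
  have htors : Module.IsTorsion (IwasawaAlgebra 2) (XAc (W.baseChange K) 2 κ 𝔭 ∅ γ) := by
    obtain ⟨m, hm, -⟩ := hctl
    exact hm.1
  exact not_controlPlusOne_of_additiveControlOnTreeAt hctl
    (hC W hCM hr hsplit2 hng N K Dt H ιK P hN hK hHN hP hnt κ hκ γ 𝔭 h𝔭 he hf htors)

/-! ## §3 The line's typed `2`-adic normalisations against the control machine -/

/-- **Granted the two torsion-finiteness atoms at `2` and Poitou–Tate, the line's typed inputs at ONE datum are jointly inconsistent with
`BSD₂` of the pair `(W, W^{(d_K)})`**: an integral ♭-BDP frame `R1.IsBDPLFunctionInt 2 ι′ 𝔭 κ γ f_W Ω_K Ω_p Q`, the ♭-IMC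
EQUALITY at `𝔭′`, Liu–Zhang–Zhang as typed at `2`, the toric published inputs, Milne 1972, `BSD₂(W)` and `BSD₂(Wd)` give
`¬ AdditiveControlOnTreeAt 2 κ 𝔭′ …` (-w2 g3, `not_additiveControlOnTreeAt_two_of_flatIMCEq_of_bsdp`: the analytic
exponent `1 + 2·ord₂ log_ω P − 2·ord₂ c` is ODD, the `K`-side `2`-part is EVEN), while §1 gives `AdditiveControlOnTreeAt 2 κ 𝔭′ …`
from the two torsion-finiteness atoms.
So on `49a1^{(d)}/K″` at least one of {a typed `2`-power constant (frame predicate / LZZ reading / IMC-equality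
normalisation), one of the four atoms, `BSD₂`} fails. CONDITIONAL; closes nothing; nothing registered is negated.
[cite: LiuZhangZhang2018, Thm 1.5.1 and Thm 1.5.3 (Duke Math. J. 167 pp. 748–749)] [cite: Milne1972ArithmeticAV, §1 Thm. 1]
[cite: JetchevSkinnerWan2017, Thm. 3.3.1 (arXiv:1512.06894 p. 11)] -/
theorem eisensteinTwoBdp_typedNormalisations_inconsistent_of_finAtoms
    (hL : LiuZhangZhang2018.thm151_thm153_modularCurve_heegnerVector_additive) (hF : ToricPublishedInputs)
    (hMilne : Milne1972.bsdQuotient_baseChange_quadratic)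
    {K : Type} [Field K] [NumberField K]
    (hPT : poitouTate_selmerStructure_duality K) (hPT2 : poitouTate_sha_tateDual K)
    (W : WeierstrassCurve ℚ) [W.IsElliptic] [W.IsGloballyMinimal] (hCM : W.HasCM) (hr : W.analyticRank = 1) (hng : ¬ Good W 2)
    (κ : ZpExtension K 2) (hκ : κ.IsAnticyclotomic) (γ : absoluteGaloisGroup K) [Fact (κ.IsTopGenerator γ)]
    {N : ℕ} [NeZero N] (Dt : ModularParametrizationData W N) (H : HeegnerDatum N (NumberField.discr K))
    (ιK : K →+* ℂ) (P : (W.baseChange K).toAffine.Point)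
    (hN : W.conductorNorm ℤ = N) (hK : IsImaginaryQuadratic K) (hHN : SatisfiesHeegnerHypothesis N K)
    (hP : WeierstrassCurve.Affine.Point.map ιK.toRatAlgHom P = heegnerPointComplex Dt H) (hnt : ¬ IsOfFinAddOrder P)
    (hLt : (W.quadraticTwist (NumberField.discr K : ℚ)).entireLFunction 1 ≠ 0)
    (Wd : WeierstrassCurve ℚ) [Wd.IsElliptic] [Wd.IsGloballyMinimal]
    (hWd : ∃ C : VariableChange ℚ, C • W.quadraticTwist (NumberField.discr K : ℚ) = Wd)
    (hBSD : BSDp W 2) (hBSDd : BSDp Wd 2)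
    (𝔭 : HeightOneSpectrum (𝓞 K)) (h𝔭 : ((2 : ℕ) : 𝓞 K) ∈ 𝔭.asIdeal) (he : 𝔭.asIdeal.ramificationIdx (𝓞 ℚ) = 1)
    (hf : 𝔭.asIdeal.inertiaDeg (𝓞 ℚ) = 1)
    (𝔭' : HeightOneSpectrum (𝓞 K)) (h𝔭' : ((2 : ℕ) : 𝓞 K) ∈ 𝔭'.asIdeal) (he' : 𝔭'.asIdeal.ramificationIdx (𝓞 ℚ) = 1)
    (hf' : 𝔭'.asIdeal.inertiaDeg (𝓞 ℚ) = 1)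
    (ι' : PadicAlgCl 2 ≃+* ℂ) (hind : SchneiderFree.BranchInducesPrime 2 ι' 𝔭)
    {ΩK' : ℂ} {Ωp' : ℂ_[2]} {Q : PowerSeries (PadicComplexInt 2)} (hΩK' : ΩK' ≠ 0) (hΩp' : Ωp' ≠ 0)
    (hQ : R1.IsBDPLFunctionInt 2 ι' 𝔭 κ γ Dt.f ΩK' Ωp' Q)
    (hEq : (XAc.charIdeal (W.baseChange K) 2 κ 𝔭' ∅ γ).map (PowerSeries.map (R1.toCpInt 2)) = Ideal.span {Q})
    (hFinG : Finite (FixedPoints.addSubgroup κ.kerSubgroup (geomPrimaryTorsion (W.baseChange K) 2)))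
    (hFinL : LocalTowerTorsionFiniteAt (W.baseChange K) 2 κ 𝔭') : False := by
  have hadd : Addv W 2 := ⟨hng, Literature.NumberTheory.EllipticCurves.Rank1Residual.not_mult_of_hasCM (W := W) hCM 2⟩
  have h4N : 2 ^ 2 ∣ W.conductorNorm ℤ := by
    by_contra h
    rcases hasGoodReductionAtPrime_or_hasMultiplicativeReductionAtPrime_of_not_sq_dvd_conductorNorm (V := W) h with hg | hm
    · exact hng hg
    · exact hadd.2 hm
  have h4N' : 2 ^ 2 ∣ N := hN ▸ h4N
  have h2N : (2 : ℕ) ∣ W.conductorNorm ℤ := dvd_trans (dvd_pow_self 2 two_ne_zero) h4N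
  have hsplit : SplitsIn K 2 := splitsIn_of_satisfiesHeegnerHypothesis hN hHN h2N
  -- rank one and `Ш(E/K)` finite from Kolyvagin (a conjunct of the toric published inputs)
  obtain ⟨hrank, hSha⟩ := hF.2.1 N W K hK hHN ⟨Dt, H, ιK, hP⟩ hnt
  exact not_additiveControlOnTreeAt_two_of_flatIMCEq_of_bsdp hL hF hMilne W K κ γ Dt H ιK P hN h4N' hK hHN hκ hP hr hLt
    Wd hWd hBSD hBSDd 𝔭 h𝔭 he hf 𝔭' h𝔭' he' hf' ι' hind hΩK' hΩp' hQ hEq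
    (additiveControlOnTreeAt_two_of_finAtoms hPT hPT2 W hadd hK hsplit h2N hrank hSha P hnt κ hκ γ 𝔭' h𝔭' he' hf'
      hFinG hFinL)

end Summit.BirchSwinnertonDyer.BirchSwinnertonDyer.Theorems.PrintCf2.EisensteinTwo

end
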